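/-
Copyright (c) 2026 the pub-hodgecm2 formalisation cell (harness21).  New file, outside the frozen port manifest.
Origin: seat `prover-pub-hodgecm2-d2bridge-prove-2-g0-0` (unit pub-hodgecm2-d2bridge-prove-2, Δ2 BRIDGE team, strategy
RE-DERIVATION), 2026-08-23 — coordinator directive «Δ2 BRIDGE: EXECUTION NOW» (pub-hodgecm2/INBOX l.10715).  KERNEL only:
theorems, no `def`, no instance, no named fact; count-neutral; HC_CM is NOT proved; «Δ2 BRIDGE CLOSED» is NOT claimed.
-/
import Summits.HodgeConjecture.CorCM.B01.Transposition.Item6PlacementJunctionTransport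
import Literature.NumberTheory.Automorphic.Liu2021.Prop413MultLeOneOfAsPrinted
import Literature.NumberTheory.Automorphic.Liu2021.Thm418BlockLeRange
import Literature.NumberTheory.Automorphic.Liu2021.Thm418CombinedOfRecords
import HarnessLib

set_option autoImplicit false

/-!
# Δ2 RE-DERIVED FROM THE PRINTED PROPOSITIONS: [Liu 2021] Thm. 4.18 + Prop. 4.13 + Def. 4.11 + the proof map (4.2)/(4.3),
# each EXACTLY AS PRINTED over ONE §4.2 datum, ⟹ the package's combined reading r8 `Thm418Combined` (= `Thm418C` at the pin)

Y. Liu, *Fourier–Jacobi cycles and arithmetic relative trace formula*, Camb. J. Math. **9** (2021) 1–147 = arXiv:2102.11518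
[Liu2021]; TeX source `FJcycle.tex` (md5 `6db49a74122d…`; `l. NNNN` = its lines).

## What this file is (Δ2 bridge, lane «prove-2 = RE-DERIVATION»)

The stage-1 package consumes [Liu2021, Thm. 4.18] through the COMBINED READING r8
`HodgeCM.Literature.Theta.LiuAlbaneseModuleDatum.Thm418Combined res cmCl` (port `HodgeCM/Literature/AlbaneseUnitaryShimuraModules.lean`
:171; its instance at the dictionary pin is `LiuDictionary.Thm418C`, `HodgeCM/Model/LiuDictionary.lean` :212, one definitional step
away — that module is behind the port hole L38 today and is NOT imported here).  The verdict of record on «cite Thm. 4.18 AS PRINTED»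
is STRONGER-IN-X (hodge-director `HM-DELTA2-CLARITY.md`, `BRIDGE-PLAN.md` §1.3 G1–G6): the printed STATEMENT is an abstract
isomorphism, while r8 speaks about the intrinsic `μ`-block of `H¹_{B,τ'}(A_∞, ℂ)` — so a bridge needs the printed inputs Liu's
PROOF uses.  The tree's Δ2 junctions of record (`…Transposition/Item6PlacementJunctionAppendixC{,Summands,Pkg,Records,Good}.lean`)
reach r8 from Thm. 4.18 as printed plus two D-SIDE READINGS per character: `hnvD` («`ω(μ,ε,χ) ≠ 0`», App. D Lem. D.1 (1)) and
`hmultD` («multiplicity one», the last sentence of the PROOF of Prop. 4.13, l. 2145, record `Prop413Data.MultOneAsPrinted`).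

THIS FILE re-derives r8 with BOTH readings gone, from numbered statements EXACTLY AS PRINTED over ONE §4.2 datum
`P : Prop413Data F E` (carriers `𝔾(𝔸_F^∞)`, `ε`, `χ`, the modules `ω(μ,ε,χ)` for ALL adèlic oscillator triples, `H¹_{B,τ'}(A_∞, ℂ)`):

* [Prop. 4.13 AS PRINTED] `h413 : Prop413AsPrinted P` with its printed hypothesis `hn : 3 ≤ P.n`, at one embedding `τ'`
  (`Prop413AsPrinted.lean`, ll. 2113–2119) — REPLACES `hmultD`: multiplicity `≤ 1` of every irreducible-or-zero representation in
  `H¹_{B,τ'}(A_∞, ℂ)` is DERIVED (Schur's lemma for irreducible admissible representations, [Bump1997, Prop. 4.2.4], tree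
  `AdmissibleDirectSum.rank_intertwiningMap_le_one_of_equivariant_directSum`, own-htheta's Q2 engine) and transported to the
  consumer's `ℂ[𝔾(𝔸_F^∞)]`-module `T.H` along the identification `eH` («`H¹_{B,τ'}(A_∞, ℂ)` IS `T.H`», X3 «H ↔ Tower»);
* [Def. 4.11 AS PRINTED] `h411` — the three printed adjectives «irreducible admissible representation» of every summand `ω_t`
  (`Def411AsPrinted.lean` READING I1/I2: irreducible-or-zero, smooth, admissible), over all admissible weight-one triples `t`;
* [Thm. 4.18 (2) + App. D Lem. D.1 (3)] `hsep` — pairwise non-isomorphy of the non-zero summands over all admissible weight-one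
  triples (same `μ`: Thm. 4.18 (2) l. 2241; across `μ`: Lem. D.1 (3) l. 5233 + local-to-global, tree
  `Prop413Data.admTriple_eq_of_areIsomorphic_of_local`), in `Prop413MultLeOneOfAsPrinted`'s shape (GUARDED by `Nontrivial`, so no
  non-vanishing is presupposed);
* [Thm. 4.18 AS PRINTED] per character `μ` of the record with `τ' ∈ Φ_μ`: `hLiu μ : Thm418AsPrinted (P.toThm418Data (R μ))` — the
  theorem's datum at the REAL weight-one conjugate symplectic character `ν μ` OVER THE CARRIERS OF `P` (`Prop413Data.Rest418` /
  `toThm418Data`: «a consumer citing BOTH Prop. 4.13 and Thm. 4.18 for the same `𝕍` does so over literally the same `G`, `Eps`, `Chi`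
  and the same modules `ω(μ,ε,χ)`», `Prop413AsPrinted.lean` :250–:310; `omegaAt_toThm418Data` is `rfl`);
* [proof of Thm. 4.18, map (4.2)/(4.3) AS PRINTED] per `μ`: the proof objects `M μ : Map43Data` (`D_μ`, `τ'`, `H¹_{B,τ'}(A_∞, ℂ)`,
  `H¹_{B,τ'}(A_μ, ℂ)`, `α`, `f ↦ f^*`) with `hM μ : Map43AsPrinted (M μ)` ((i) eigenline of dimension 1, (ii) `ℂ[𝔾(𝔸_F^∞)]`-linear,
  (iii) injective; `Thm418ProofMapAsPrinted.lean`, ll. 2247–2268) — over the RATIONAL record `Map43RationalData` (i)(ii)(iii) are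
  THEOREMS (`Map43RationalData.map43AsPrinted`), whence the `_records` corollary;
* NO `hnvD`: the kernel step «block ≤ range» is re-proved here WITHOUT the non-vanishing of the summands
  (`block_le_range_of_rank_hom_le_one_of_injective`: a zero summand contributes nothing), so App. D Lem. D.1 (1) leaves the display.

## THE EXACT RESIDUAL (what is NOT a printed sentence — each an explicit, named binder of `thm418Combined_of_printedPropositions`)

* (H)  `eH : P.HB τ' ≃ₗ[ℂ] T.H`, `heH` (equivariance) — «the carrier `H¹_{B,τ'}(A_∞, ℂ)` of Prop. 4.13 IS the consumer's `T.H`»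
  (at an honest pin `P.HB τ' := T.H`, `eH := LinearEquiv.refl`; BRIDGE-PLAN G2);
* (J)  `jH μ : (M μ).HB →ₗ[ℂ] T.H`, `hjHinj`, `hjH` — the reading of the proof's `H¹_{B,τ'}(A_∞, ℂ)` into `T.H` (honest pin:
  `HB := T.H`, `jH := id`; BRIDGE-PLAN S4);
* (Ω)  `σ μ`, `hσ`, `e μ a : T.Ω μ a ≃ₗ[ℂ] ω(ν μ, σ a)`, `he` — the record's `μ`-pieces ARE Liu's summands (X3 «ω ↔ Ω»; G3/M3);
* (ν/R) `ν μ` the real idele class character of the index `μ` and `R μ : P.Rest418 (ν μ)` the Thm-4.18 carriers at it (G1);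
* (C)  `hcm μ K φ` — Liu's OWN class `(φ^*α)|_K`, read into `W K`, is one of the consumer's CM classes (Lem. 2.4 (1) l. 1210–1213 +
  functoriality of Betti `H¹` + the `cmCl` contract; G5);
* the level dictionary `hmono`/`hoc`/`hcof` («sufficiently small», l. 2060/2239; CLOSED in the tree at the ported levels, G4).
Nothing else: no `hnv`, no `hmult`, no `Φ`, no `hblock`, no `J`/`hJ`/`hJinj`, no `MultOneAsPrinted`, no compact-open witness (`hK` is
READ OFF Thm. 4.18 (1) at the proof's object `D_μ`).

KERNEL: per `μ`, `hmultD` := `rank_intertwiningMap_ofModule'_le_one_of_prop413AsPrinted` (Prop. 4.13's `Φ` transported along `eH`)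
∘ `Thm418Data.rank_linearMap_asModule_le_rank_intertwiningMap_ofModule'` ∘ item6-p2's `rank_hom_le_one_of_summand_equiv`; the
realisation `g := jH ∘ (4.3) ∘ Φ₄₁₈⁻¹ ∘ ψ_{σ,e}` with its generation clause := item6-p2's `thm418Realised_of_asPrinted_summands` at
`J := jH ∘ (M μ).J` (`Map43Data.hJ_of_asPrinted`, `injective_J_of_asPrinted`, `J_one_tmul_res`); then `block ≤ range g` WITHOUT `hnv`.
At the port instance (`P.G = ↥V.adelicFin`, `T := (liuDictionaryPin …).toLiuAlbaneseModuleDatum`, `res := T.res`,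
`cmCl := T.cmClasses`) the conclusion is LITERALLY `LiuDictionary.Thm418C` — port-gated (L38/L45/L67), not claimed here.
HC_CM is NOT proved; no pin is discharged; nothing about Liu's objects is constructed or asserted; «Δ2 BRIDGE CLOSED» is NOT claimed.

## References
* [Liu2021] §4.2 ll. 2053–2081; Def. 4.11 (ll. 2083–2097); Prop. 4.13 (ll. 2113–2119) and proof l. 2145; Def. 4.16, Rem. 4.17
  (ll. 2215–2228); Thm. 4.18 (ll. 2232–2245) with proof and map (4.2)/(4.3) (ll. 2247–2268); Lem. 2.4 (1) (ll. 1210–1213);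
  App. D Lem. D.1 (1), (3) (ll. 5226–5233).
* [Bump1997] D. Bump, *Automorphic Forms and Representations*, CUP 1997, Prop. 4.2.4.
* Tree: `Liu2021.Prop413AsPrinted` / `Prop413MultLeOneOfAsPrinted` (own-htheta), `Liu2021.Thm418AsPrinted`, `Thm418ProofMapAsPrinted` /
  `Thm418ProofMapRational` (item6-p1), `Thm418BlockLeRange` / `Thm418CombinedOfRecords` (tr-prover-6), `Transposition/Item6PlacementJunction`
  + `…Transport` (item6-p2), `RepresentationTheory/AdmissibleDirectSumMultiplicityOne` (own-htheta).
-/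

noncomputable section

open scoped DirectSum TensorProduct

namespace Summit.HodgeConjecture.CorCM.D2Bridge

open HodgeCM.Literature.Theta HodgeCM.Literature.Theta.LiuAlbaneseModuleDatum
open Literature.NumberTheory.Automorphic Literature.NumberTheory.Automorphic.Liu2021 Literature.RepresentationTheory NumberField

universe u v w

/-! ## §0  Kernel: `block μ ≤ range g` from multiplicity `≤ 1` alone — NO non-vanishing of the summands -/

/-- **Multiplicity-one placement without `ω ≠ 0`.**  If every multiplicity space `Hom_{ℂ[G]}(ω_T(μ,a), H)` has `ℂ`-rank `≤ 1` and
`g : ⨁_a ω_T(μ,a) → H` is `ℂ[G]`-linear and injective, then the intrinsic `μ`-block `⨆_a ⨆_ψ range ψ` lies in `range g` — as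
item6-p2's `block_le_range_of_rank_hom_le_one`, but with NO `Nontrivial (T.Ω μ a)` hypothesis: a summand on which the component
`g ∘ ι_a` vanishes is itself zero (injectivity), so every `ψ` out of it vanishes too. [folklore] -/
theorem block_le_range_of_rank_hom_le_one_of_injective {G : Type u} [Group G] {Lvl : Type v} {Kof : Lvl → Subgroup G}
    {T : LiuAlbaneseModuleDatum G Kof} {μ : T.Char}
    (hmult : ∀ a : T.Adm μ, Module.rank ℂ (T.Ω μ a →ₗ[MonoidAlgebra ℂ G] T.H) ≤ 1)
    {g : (⨁ a : T.Adm μ, T.Ω μ a) →ₗ[MonoidAlgebra ℂ G] T.H} (hg : Function.Injective g) :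
    T.block μ ≤ (LinearMap.range g).restrictScalars ℂ := by
  classical
  refine block_le fun a ψ => ?_
  -- the `a`-th component `g ∘ ι_a` of the realisation
  let ga : T.Ω μ a →ₗ[MonoidAlgebra ℂ G] T.H := g ∘ₗ DirectSum.lof (MonoidAlgebra ℂ G) (T.Adm μ) (fun a => T.Ω μ a) a
  by_cases ha : ga = 0
  · -- `g ∘ ι_a = 0` forces `ω_T(μ,a) = 0` (`g` and `ι_a` injective), hence `ψ = 0`
    rintro x ⟨m, rfl⟩
    have h1 : g (DirectSum.lof (MonoidAlgebra ℂ G) (T.Adm μ) (fun a => T.Ω μ a) a m) = g 0 := by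
      rw [map_zero]
      exact LinearMap.congr_fun ha m
    have h2 : DirectSum.lof (MonoidAlgebra ℂ G) (T.Adm μ) (fun a => T.Ω μ a) a m =
        DirectSum.lof (MonoidAlgebra ℂ G) (T.Adm μ) (fun a => T.Ω μ a) a 0 := by
      rw [map_zero]; exact hg h1
    have hm : m = 0 := DirectSum.of_injective (β := fun a => T.Ω μ a) a h2
    rw [hm, map_zero]
    exact Submodule.zero_mem _
  · intro x hx
    exact LinearMap.range_comp_le_range (DirectSum.lof (MonoidAlgebra ℂ G) (T.Adm μ) (fun a => T.Ω μ a) a) g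
      (Literature.RepresentationTheory.Liu2021.range_le_range_of_rank_hom_le_one (hmult a) ha ψ hx)

/-! ## §1  [Liu2021, Prop. 4.13] AS PRINTED ⟹ multiplicity `≤ 1` INTO THE CONSUMER'S `ℂ[𝔾(𝔸_F^∞)]`-MODULE (the `hmultD` currency) -/

section Multiplicity

variable {F E : Type} [Field F] [NumberField F] [IsTotallyReal F] [Field E] [NumberField E] [Algebra F E]
  [IsTotallyComplex E] [Algebra.IsQuadraticExtension F E] {P : Prop413Data F E}

/-- `Representation.ofModule' H g h = of g • h` (Mathlib's `ofModule'`, unfolded; private plumbing). [folklore] -/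
private theorem ofModule'_apply_eq {G : Type u} [Group G] {H : Type w} [AddCommGroup H] [Module ℂ H]
    [Module (MonoidAlgebra ℂ G) H] [IsScalarTower ℂ (MonoidAlgebra ℂ G) H] (g : G) (h : H) :
    Representation.ofModule' (k := ℂ) (G := G) H g h = MonoidAlgebra.of ℂ G g • h := by
  simp only [Representation.ofModule', MonoidAlgebra.lift_symm_apply, Algebra.lsmul_coe, MonoidAlgebra.of_apply]

/-- **[Liu2021, Prop. 4.13] AS PRINTED ⟹ multiplicity at most one in the consumer's module** (the `hmultD` binder of the Δ2
junctions, DERIVED).  Inputs by name: `h413 : Prop413AsPrinted P` with its printed hypothesis `3 ≤ P.n` at an embedding `τ'`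
(ll. 2113–2119: `H¹_{B,τ'}(A_∞, ℂ) ≃ ⊕_t ω_t` as `ℂ[𝔾(𝔸_F^∞)]`-modules); `h411` = Def. 4.11's printed adjectives of every summand
(irreducible — zero allowed —, smooth, admissible); `hsep` = pairwise non-isomorphy of the non-zero summands (Thm. 4.18 (2), l. 2241,
and App. D Lem. D.1 (3), l. 5233); `hK` = one compact open subgroup of `𝔾(𝔸_F^∞)`; and the IDENTIFICATION (H) of the carrier
`H¹_{B,τ'}(A_∞, ℂ)` with a `ℂ[𝔾(𝔸_F^∞)]`-module `H` of the consumer's — a `ℂ`-linear equivalence `eH` intertwining `P.rhoB τ'` with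
the module action (`heH`).  Conclusion: for EVERY irreducible-or-zero representation `ρ` of `𝔾(𝔸_F^∞)`,
`dim_ℂ Hom_{𝔾}(ρ, ofModule' H) ≤ 1`.  Proof: Prop. 4.13's isomorphism transported along `eH` is an equivariant decomposition of
`ofModule' H`; then Schur's lemma for irreducible admissible representations [Bump1997, Prop. 4.2.4] in the Hom-space form
`AdmissibleDirectSum.rank_intertwiningMap_le_one_of_equivariant_directSum` (as in own-htheta's
`Prop413Data.rank_intertwiningMap_le_one_of_asPrinted`, whose target is `P.rhoB τ'` itself).  HC_CM is NOT proved.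
[cite: Liu2021, Prop. 4.13 (ll. 2113–2119) with proof l. 2145; Def. 4.11; Thm. 4.18 (2); App. D Lemma D.1 (3)] -/
theorem rank_intertwiningMap_ofModule'_le_one_of_prop413AsPrinted (h413 : Prop413AsPrinted P) (hn : 3 ≤ P.n)
    (τ' : E →+* ℂ)
    (h411 : ∀ t : P.AdmTriple,
      IsIrreducibleOrZero (P.rhoAt t) ∧ IsSmoothRep (P.rhoAt t) ∧ IsAdmissibleRep (P.rhoAt t))
    (hsep : ∀ s t : P.AdmTriple, Nontrivial (P.omegaAt s) →
      (∃ f : P.omegaAt s ≃ₗ[ℂ] P.omegaAt t, ∀ (g : P.G) (v : P.omegaAt s), f (P.rhoAt s g v) = P.rhoAt t g (f v)) →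
      s = t)
    (hK : ∃ K : Subgroup P.G, IsOpenCompact K)
    {H : Type w} [AddCommGroup H] [Module ℂ H] [Module (MonoidAlgebra ℂ P.G) H] [IsScalarTower ℂ (MonoidAlgebra ℂ P.G) H]
    (eH : P.HB τ' ≃ₗ[ℂ] H) (heH : ∀ (g : P.G) (x : P.HB τ'), eH (P.rhoB τ' g x) = MonoidAlgebra.of ℂ P.G g • eH x)
    {V : Type} [AddCommGroup V] [Module ℂ V] (ρ : Representation ℂ P.G V) (hρ : IsIrreducibleOrZero ρ) :
    Module.rank ℂ (Representation.IntertwiningMap ρ (Representation.ofModule' (k := ℂ) (G := P.G) H)) ≤ 1 := by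
  by_cases hV : Nontrivial V
  · haveI := isIrreducible_of_isIrreducibleOrZero hρ hV
    obtain ⟨Φ, hΦ⟩ := h413 hn τ'
    -- Prop. 4.13's isomorphism read on `H` along `eH` is an equivariant decomposition of `ofModule' H`
    have hΦ' : ∀ (g : P.G) (x : H) (t : P.AdmTriple),
        (eH.symm.trans Φ) (Representation.ofModule' (k := ℂ) (G := P.G) H g x) t =
          P.rhoAt t g ((eH.symm.trans Φ) x t) := by
      intro g x t
      have hx : eH.symm (MonoidAlgebra.of ℂ P.G g • x) = P.rhoB τ' g (eH.symm x) :=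
        eH.injective (by rw [LinearEquiv.apply_symm_apply, heH, LinearEquiv.apply_symm_apply])
      rw [LinearEquiv.trans_apply, LinearEquiv.trans_apply, ofModule'_apply_eq, hx, hΦ]
    refine AdmissibleDirectSum.rank_intertwiningMap_le_one_of_equivariant_directSum (σ := fun t => P.rhoAt t)
      (eH.symm.trans Φ) hΦ'
      (fun t ht => isIrreducible_of_isIrreducibleOrZero (h411 t).1 ht)
      (fun t => isAdmissible_of_isSmoothRep_of_isAdmissibleRep (h411 t).2.1 (h411 t).2.2)
      (fun s t hs ⟨e⟩ => hsep s t hs ⟨e.toLinearEquiv, fun g v => ?_⟩) ?_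
    · rw [Representation.Equiv.toLinearEquiv_apply, Representation.Equiv.toLinearEquiv_apply]
      exact e.toIntertwiningMap.isIntertwining _ _ g v
    · obtain ⟨K, hKo, hKc⟩ := hK
      exact ⟨K, hKo, hKc⟩
  · -- the zero representation: every intertwiner out of it vanishes
    haveI : Subsingleton V := not_nontrivial_iff_subsingleton.mp hV
    rw [rank_le_one_iff]
    exact ⟨0, fun f => ⟨0, by
      rw [smul_zero]
      exact Representation.IntertwiningMap.ext (LinearMap.ext fun v => by
        rw [Subsingleton.elim v 0, map_zero, map_zero])⟩⟩

end Multiplicity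

/-! ## §2  Per character: «Thm. 4.18 REALISED in `T.H`» from Thm. 4.18 AS PRINTED + the proof map (4.2)/(4.3) AS PRINTED -/

section PerCharacter

variable {F E : Type} [Field F] [NumberField F] [IsTotallyReal F] [Field E] [NumberField E] [Algebra F E]
  [IsTotallyComplex E] [Algebra.IsQuadraticExtension F E]

/-- **«Thm. 4.18 realised at `μ`» from the two printed records.**  For Liu's datum `D` with THE CITE `hLiu : Thm418AsPrinted D`
(l. 2232–2245), a record `T` over `D.G`, a character `μ` of `T` whose pieces are among Liu's summands (`σ` injective, `e a`
equivariant `ℂ`-linear identifications), the PROOF OBJECTS `M : D.Map43Data` with `hM : Map43AsPrinted M` (l. 2247–2268: (i) the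
`M_μ`-eigenline of `H¹_{B,τ'}(A_μ, ℂ)` is a line, (ii) `f ↦ f^*α` is `ℂ[𝔾(𝔸_F^∞)]`-linear, (iii) (4.3) is injective), the reading
`jH : H¹_{B,τ'}(A_∞, ℂ) → T.H` (injective, equivariant), and the class identification `hcm` on LIU'S OWN classes `φ^*α`,
`φ ∈ Hom_E(A_K, A_μ)_ℚ` (Lem. 2.4 (1), l. 1210–1213): an injective `ℂ[G]`-linear `g : ⨁_a ω_T(μ,a) → T.H` whose `K`-fixed values
restrict into `span ℂ (cmCl K μ)` for `K` below some level.  KERNEL: item6-p2's `thm418Realised_of_asPrinted_summands` at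
`J := jH ∘ (4.3)`, with `hJ` / `hJinj` / `hpin` supplied by `Map43Data.hJ_of_asPrinted` / `injective_J_of_asPrinted` / `J_one_tmul_res`.
HC_CM is NOT proved. [cite: Liu2021, Thm. 4.18 with Thm. 4.18 (1) (ll. 2232–2245) and its proof, map (4.2)/(4.3) (ll. 2247–2268); Lem. 2.4 (1) (ll. 1210–1213)] -/
theorem thm418Realised_of_asPrinted_of_map43AsPrinted (D : Thm418Data F E) {Lvl : Type v} [Preorder Lvl]
    {Kof : Lvl → Subgroup D.G} {T : LiuAlbaneseModuleDatum D.G Kof}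
    {W : Lvl → Type w} [∀ K, AddCommGroup (W K)] [∀ K, Module ℂ (W K)]
    {res : ∀ K : Lvl, T.H →ₗ[ℂ] W K} {cmCl : ∀ K : Lvl, T.Char → Set (W K)} {μ : T.Char}
    (hLiu : Thm418AsPrinted D)
    (hmono : ∀ ⦃K K' : Lvl⦄, K ≤ K' → Kof K ≤ Kof K') (hoc : ∀ K : Lvl, IsOpenCompact (Kof K))
    (hcof : ∀ K₀ : Subgroup D.G, IsOpenCompact K₀ → ∃ K₁ : Lvl, Kof K₁ ≤ K₀)
    (σ : T.Adm μ → D.AdmIndex) (hσ : Function.Injective σ)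
    (e : ∀ a : T.Adm μ, T.Ω μ a ≃ₗ[ℂ] D.omegaAt (σ a))
    (he : ∀ (a : T.Adm μ) (g : D.G) (m : T.Ω μ a), e a (MonoidAlgebra.of ℂ D.G g • m) = D.rhoAt (σ a) g (e a m))
    (M : D.Map43Data) (hM : Map43AsPrinted M)
    (jH : M.HB →ₗ[ℂ] T.H) (hjHinj : Function.Injective jH)
    (hjH : ∀ (g : D.G) (x : M.HB), jH (M.ρB g x) = MonoidAlgebra.of ℂ D.G g • jH x)
    (hcm : ∀ (K : Lvl) (φ : D.HomK (Kof K) M.Dμ), res K (jH (M.pull (D.res (Kof K) M.Dμ φ) M.α)) ∈ cmCl K μ) :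
    ∃ g : (⨁ a : T.Adm μ, T.Ω μ a) →ₗ[MonoidAlgebra ℂ D.G] T.H, Function.Injective g ∧
      ∃ K₀ : Lvl, ∀ K ≤ K₀, ∀ y, g y ∈ fixedBy (Kof K) T.H → res K (g y) ∈ Submodule.span ℂ (cmCl K μ) :=
  thm418Realised_of_asPrinted_summands D hLiu hmono hoc hcof σ hσ e he (jH ∘ₗ M.J)
    (hjHinj.comp (Thm418Data.Map43Data.injective_J_of_asPrinted hM))
    (fun g x => by
      rw [LinearMap.comp_apply, LinearMap.comp_apply, Thm418Data.Map43Data.hJ_of_asPrinted hM, hjH])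
    M.Dμ
    (fun K φ => by
      rw [LinearMap.comp_apply, Thm418Data.Map43Data.J_one_tmul_res]
      exact hcm K φ)

end PerCharacter

/-! ## §3  THE BRIDGE FROM THE PRINTED PROPOSITIONS -/

section Bridge

variable {F E : Type} [Field F] [NumberField F] [IsTotallyReal F] [Field E] [NumberField E] [Algebra F E]
  [IsTotallyComplex E] [Algebra.IsQuadraticExtension F E]

/-- **Δ2 RE-DERIVED FROM THE PRINTED PROPOSITIONS — [Liu2021] Prop. 4.13 + Def. 4.11 + Thm. 4.18 + the proof map (4.2)/(4.3), each
EXACTLY AS PRINTED over ONE §4.2 datum `P`, ⟹ the package's combined reading r8 `T.Thm418Combined res cmCl`** for every record `T`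
over `𝔾(𝔸_F^∞) = P.G` (at the dictionary pin: `= LiuDictionary.Thm418C`, one definitional step, port-gated).
PRINTED INPUTS: `hn`/`h413` [Prop. 4.13, ll. 2113–2119]; `h411` [Def. 4.11, ll. 2092–2096] at every admissible weight-one triple;
`hsep` [Thm. 4.18 (2), l. 2241, + App. D Lem. D.1 (3), l. 5233] (guarded by non-vanishing); per character `μ` of `T` with `τ' ∈ Φ_μ`:
`hLiu μ` [Thm. 4.18, ll. 2232–2245] for the datum at the real weight-one conjugate symplectic `ν μ` over the carriers of `P`
(`P.toThm418Data (R μ)`), and `hM μ` [proof of Thm. 4.18, (4.2)/(4.3), ll. 2247–2268] for the proof objects `M μ`.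
THE RESIDUAL (named binders, none a printed sentence): (H) `eH`/`heH` — `H¹_{B,τ'}(A_∞, ℂ)` IS `T.H`; (J) `jH`/`hjHinj`/`hjH` — the
proof's `H¹_{B,τ'}(A_∞, ℂ)` read into `T.H`; (Ω) `σ`/`hσ`/`e`/`he` — the record's `μ`-pieces are Liu's summands; (ν/R) the real character
and Thm-4.18 carriers of each index; (C) `hcm` — Liu's own classes `(φ^*α)|_K` are CM classes of the consumer (Lem. 2.4 (1),
ll. 1210–1213); the level dictionary `hmono`/`hoc`/`hcof` (l. 2060/2239).  NO `hnvD`, NO `hmultD`, NO `Φ`/`hblock`/`J`/`hJ`/`hJinj`,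
NO compact-open witness (read off Thm. 4.18 (1) at `D_μ`).  KERNEL: §1 + `Thm418Data.rank_linearMap_asModule_le_rank_intertwiningMap_ofModule'`
+ item6-p2's `rank_hom_le_one_of_summand_equiv` give multiplicity `≤ 1` on the record's pieces; §2 gives the realisation; §0 places
the block in its range.  HC_CM is NOT proved; no pin is discharged; nothing about Liu's objects is constructed or asserted;
«Δ2 BRIDGE CLOSED» is NOT claimed.
[cite: Liu2021, Prop. 4.13 (ll. 2113–2119); Def. 4.11 (ll. 2083–2097); Thm. 4.18 with (1), (2) (ll. 2232–2245) and its proof, map (4.2)/(4.3) (ll. 2247–2268); Rem. 4.17 (ll. 2226–2228); Lem. 2.4 (1) (ll. 1210–1213); App. D Lemma D.1 (3) (l. 5233)]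
[cite: Bump1997, Proposition 4.2.4] -/
theorem thm418Combined_of_printedPropositions
    (P : Prop413Data F E) (hn : 3 ≤ P.n) (τ' : E →+* ℂ) (h413 : Prop413AsPrinted P)
    (h411 : ∀ t : P.AdmTriple,
      IsIrreducibleOrZero (P.rhoAt t) ∧ IsSmoothRep (P.rhoAt t) ∧ IsAdmissibleRep (P.rhoAt t))
    (hsep : ∀ s t : P.AdmTriple, Nontrivial (P.omegaAt s) →
      (∃ f : P.omegaAt s ≃ₗ[ℂ] P.omegaAt t, ∀ (g : P.G) (v : P.omegaAt s), f (P.rhoAt s g v) = P.rhoAt t g (f v)) →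
      s = t)
    {Lvl : Type v} [Preorder Lvl] {Kof : Lvl → Subgroup P.G} (T : LiuAlbaneseModuleDatum P.G Kof)
    {W : Lvl → Type w} [∀ K, AddCommGroup (W K)] [∀ K, Module ℂ (W K)]
    (res : ∀ K : Lvl, T.H →ₗ[ℂ] W K) (cmCl : ∀ K : Lvl, T.Char → Set (W K))
    (hmono : ∀ ⦃K K' : Lvl⦄, K ≤ K' → Kof K ≤ Kof K') (hoc : ∀ K : Lvl, IsOpenCompact (Kof K))
    (hcof : ∀ K₀ : Subgroup P.G, IsOpenCompact K₀ → ∃ K₁ : Lvl, Kof K₁ ≤ K₀)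
    (eH : P.HB τ' ≃ₗ[ℂ] T.H)
    (heH : ∀ (g : P.G) (x : P.HB τ'), eH (P.rhoB τ' g x) = MonoidAlgebra.of ℂ P.G g • eH x)
    (ν : ∀ μ : T.Char, T.PhiMu μ → (IdeleClassGroup E →ₜ* Circle))
    (R : ∀ (μ : T.Char) (hμ : T.PhiMu μ), P.Rest418 (ν μ hμ))
    (hLiu : ∀ (μ : T.Char) (hμ : T.PhiMu μ), Thm418AsPrinted (P.toThm418Data (R μ hμ)))
    (σ : ∀ (μ : T.Char) (hμ : T.PhiMu μ), T.Adm μ → (P.toThm418Data (R μ hμ)).AdmIndex)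
    (hσ : ∀ (μ : T.Char) (hμ : T.PhiMu μ), Function.Injective (σ μ hμ))
    (e : ∀ (μ : T.Char) (hμ : T.PhiMu μ) (a : T.Adm μ), T.Ω μ a ≃ₗ[ℂ] (P.toThm418Data (R μ hμ)).omegaAt (σ μ hμ a))
    (he : ∀ (μ : T.Char) (hμ : T.PhiMu μ) (a : T.Adm μ) (g : P.G) (m : T.Ω μ a),
      e μ hμ a (MonoidAlgebra.of ℂ P.G g • m) = (P.toThm418Data (R μ hμ)).rhoAt (σ μ hμ a) g (e μ hμ a m))
    (M : ∀ (μ : T.Char) (hμ : T.PhiMu μ), (P.toThm418Data (R μ hμ)).Map43Data)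
    (hM : ∀ (μ : T.Char) (hμ : T.PhiMu μ), Map43AsPrinted (M μ hμ))
    (jH : ∀ (μ : T.Char) (hμ : T.PhiMu μ), (M μ hμ).HB →ₗ[ℂ] T.H)
    (hjHinj : ∀ (μ : T.Char) (hμ : T.PhiMu μ), Function.Injective (jH μ hμ))
    (hjH : ∀ (μ : T.Char) (hμ : T.PhiMu μ) (g : P.G) (x : (M μ hμ).HB),
      jH μ hμ ((M μ hμ).ρB g x) = MonoidAlgebra.of ℂ P.G g • jH μ hμ x)
    (hcm : ∀ (μ : T.Char) (hμ : T.PhiMu μ) (K : Lvl)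
      (φ : (P.toThm418Data (R μ hμ)).HomK (Kof K) (M μ hμ).Dμ),
      res K (jH μ hμ ((M μ hμ).pull ((P.toThm418Data (R μ hμ)).res (Kof K) (M μ hμ).Dμ φ) (M μ hμ).α)) ∈ cmCl K μ) :
    T.Thm418Combined res cmCl := by
  intro μ hμ
  -- a compact open subgroup of `𝔾(𝔸_F^∞)` EXISTS: item (1) of Thm. 4.18 as printed, at the proof's object `D_μ`
  have hK : ∃ K : Subgroup P.G, IsOpenCompact K := by
    obtain ⟨K₀, hK₀, -⟩ := Thm418Data.exists_injective_res (hLiu μ hμ) (M μ hμ).Dμ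
    exact ⟨K₀, hK₀⟩
  -- the record `T` lives over `P.G = (P.toThm418Data (R μ hμ)).G` (`rfl`)
  letI : Module (MonoidAlgebra ℂ (P.toThm418Data (R μ hμ)).G) T.H := T.instH₃
  haveI : IsScalarTower ℂ (MonoidAlgebra ℂ (P.toThm418Data (R μ hμ)).G) T.H := T.instH₄
  -- multiplicity `≤ 1` of Liu's summands in `T.H`, DERIVED from Prop. 4.13 as printed (§1), in `ℂ[G]`-linear currency
  have hmultD : ∀ i : (P.toThm418Data (R μ hμ)).AdmIndex,
      Module.rank ℂ (((P.toThm418Data (R μ hμ)).rhoAt i).asModule →ₗ[MonoidAlgebra ℂ (P.toThm418Data (R μ hμ)).G] T.H)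
        ≤ 1 := fun i =>
    (Thm418Data.rank_linearMap_asModule_le_rank_intertwiningMap_ofModule' (H := T.H) i).trans
      (rank_intertwiningMap_ofModule'_le_one_of_prop413AsPrinted h413 hn τ' h411 hsep hK eH heH
        ((P.toThm418Data (R μ hμ)).rhoAt i) (h411 (P.admTripleOf (R μ hμ) i)).1)
  -- … transported to the record's pieces along `(σ, e)`
  have hmult : ∀ a : T.Adm μ, Module.rank ℂ (T.Ω μ a →ₗ[MonoidAlgebra ℂ P.G] T.H) ≤ 1 :=
    rank_hom_le_one_of_summand_equiv (P.toThm418Data (R μ hμ)) T (σ μ hμ) (e μ hμ) (he μ hμ) hmultD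
  -- the realisation from Thm. 4.18 as printed + (4.2)/(4.3) as printed (§2)
  obtain ⟨g, hg, K₀, hK₀⟩ := thm418Realised_of_asPrinted_of_map43AsPrinted (P.toThm418Data (R μ hμ)) (T := T)
    (res := res) (cmCl := cmCl) (hLiu μ hμ) hmono hoc hcof (σ μ hμ) (hσ μ hμ) (e μ hμ) (he μ hμ) (M μ hμ) (hM μ hμ)
    (jH μ hμ) (hjHinj μ hμ) (hjH μ hμ) (hcm μ hμ)
  refine ⟨K₀, fun K hKle x hx hfix => ?_⟩
  obtain ⟨y, rfl⟩ : x ∈ (LinearMap.range g).restrictScalars ℂ :=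
    block_le_range_of_rank_hom_le_one_of_injective hmult hg hx
  exact hK₀ K hKle y hfix

/-- **The same over the RATIONAL RECORD of the proof objects** (`Map43RationalData`, item6-p1's `Thm418ProofMapRational.lean`: `D_μ`,
`τ'`, `H¹_{B,τ'}(A_∞, ℚ)` with its Hecke action and the comparison `ι` into the complex carrier, `H¹_{B,τ'}(A_μ, ℚ)` an `M_μ`-line, `α`,
`f ↦ f^*` with its laws), on which the printed assertions (i)(ii)(iii) about (4.2)/(4.3) are THEOREMS
(`Map43RationalData.map43AsPrinted`, finiteness by `finite_rat_L`): the binder `hM` disappears and the class contract `hcm` is stated on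
the record's formula `ι ((φ^*)_ℂ α)` for Liu's class `φ^*α`.  HC_CM is NOT proved; no pin is discharged; «Δ2 BRIDGE CLOSED» is NOT claimed.
[cite: Liu2021, Prop. 4.13 (ll. 2113–2119); Def. 4.11 (ll. 2083–2097); Thm. 4.18 with (1), (2) (ll. 2232–2245) and its proof, map (4.2)/(4.3) (ll. 2247–2268); Lem. 2.4 (1) (ll. 1210–1213); App. D Lemma D.1 (3) (l. 5233)]
[cite: Bump1997, Proposition 4.2.4] -/
theorem thm418Combined_of_printedPropositions_records
    (P : Prop413Data F E) (hn : 3 ≤ P.n) (τ' : E →+* ℂ) (h413 : Prop413AsPrinted P)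
    (h411 : ∀ t : P.AdmTriple,
      IsIrreducibleOrZero (P.rhoAt t) ∧ IsSmoothRep (P.rhoAt t) ∧ IsAdmissibleRep (P.rhoAt t))
    (hsep : ∀ s t : P.AdmTriple, Nontrivial (P.omegaAt s) →
      (∃ f : P.omegaAt s ≃ₗ[ℂ] P.omegaAt t, ∀ (g : P.G) (v : P.omegaAt s), f (P.rhoAt s g v) = P.rhoAt t g (f v)) →
      s = t)
    {Lvl : Type v} [Preorder Lvl] {Kof : Lvl → Subgroup P.G} (T : LiuAlbaneseModuleDatum P.G Kof)
    {W : Lvl → Type w} [∀ K, AddCommGroup (W K)] [∀ K, Module ℂ (W K)]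
    (res : ∀ K : Lvl, T.H →ₗ[ℂ] W K) (cmCl : ∀ K : Lvl, T.Char → Set (W K))
    (hmono : ∀ ⦃K K' : Lvl⦄, K ≤ K' → Kof K ≤ Kof K') (hoc : ∀ K : Lvl, IsOpenCompact (Kof K))
    (hcof : ∀ K₀ : Subgroup P.G, IsOpenCompact K₀ → ∃ K₁ : Lvl, Kof K₁ ≤ K₀)
    (eH : P.HB τ' ≃ₗ[ℂ] T.H)
    (heH : ∀ (g : P.G) (x : P.HB τ'), eH (P.rhoB τ' g x) = MonoidAlgebra.of ℂ P.G g • eH x)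
    (ν : ∀ μ : T.Char, T.PhiMu μ → (IdeleClassGroup E →ₜ* Circle))
    (R : ∀ (μ : T.Char) (hμ : T.PhiMu μ), P.Rest418 (ν μ hμ))
    (hLiu : ∀ (μ : T.Char) (hμ : T.PhiMu μ), Thm418AsPrinted (P.toThm418Data (R μ hμ)))
    (σ : ∀ (μ : T.Char) (hμ : T.PhiMu μ), T.Adm μ → (P.toThm418Data (R μ hμ)).AdmIndex)
    (hσ : ∀ (μ : T.Char) (hμ : T.PhiMu μ), Function.Injective (σ μ hμ))
    (e : ∀ (μ : T.Char) (hμ : T.PhiMu μ) (a : T.Adm μ), T.Ω μ a ≃ₗ[ℂ] (P.toThm418Data (R μ hμ)).omegaAt (σ μ hμ a))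
    (he : ∀ (μ : T.Char) (hμ : T.PhiMu μ) (a : T.Adm μ) (g : P.G) (m : T.Ω μ a),
      e μ hμ a (MonoidAlgebra.of ℂ P.G g • m) = (P.toThm418Data (R μ hμ)).rhoAt (σ μ hμ a) g (e μ hμ a m))
    (M : ∀ (μ : T.Char) (hμ : T.PhiMu μ), (P.toThm418Data (R μ hμ)).Map43RationalData)
    (jH : ∀ (μ : T.Char) (hμ : T.PhiMu μ), (M μ hμ).HB →ₗ[ℂ] T.H)
    (hjHinj : ∀ (μ : T.Char) (hμ : T.PhiMu μ), Function.Injective (jH μ hμ))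
    (hjH : ∀ (μ : T.Char) (hμ : T.PhiMu μ) (g : P.G) (x : (M μ hμ).HB),
      jH μ hμ ((M μ hμ).ρB g x) = MonoidAlgebra.of ℂ P.G g • jH μ hμ x)
    (hcm : ∀ (μ : T.Char) (hμ : T.PhiMu μ) (K : Lvl)
      (φ : (P.toThm418Data (R μ hμ)).HomK (Kof K) (M μ hμ).Dμ),
      res K (jH μ hμ ((M μ hμ).ι
        (((M μ hμ).P ((P.toThm418Data (R μ hμ)).res (Kof K) (M μ hμ).Dμ φ)).baseChange ℂ (M μ hμ).α))) ∈ cmCl K μ) :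
    T.Thm418Combined res cmCl := by
  refine thm418Combined_of_printedPropositions P hn τ' h413 h411 hsep T res cmCl hmono hoc hcof eH heH ν R hLiu σ hσ e he
    (fun μ hμ => (M μ hμ).toMap43Data) (fun μ hμ => ?_) jH hjHinj hjH (fun μ hμ K φ => ?_)
  · -- (i)(ii)(iii) of the proof are THEOREMS over the rational record
    haveI := (M μ hμ).finite_rat_L
    exact (M μ hμ).map43AsPrinted
  · -- Liu's class `φ^*α` on the rational record: `pull (res φ) α = ι ((φ^*)_ℂ α)`
    show res K (jH μ hμ (((M μ hμ).ι ∘ₗ ((M μ hμ).P _).baseChange ℂ) (M μ hμ).α)) ∈ _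
    rw [LinearMap.comp_apply]
    exact hcm μ hμ K φ

end Bridge

end Summit.HodgeConjecture.CorCM.D2Bridge

end
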